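import Summits.Ventures.YMGap.RobustBall.FiniteHeatBathKernel
import HarnessLib

/-!
# RobustBall/FiniteGibbsAverages — finite-volume Gibbs averages: the finite DLR identity for heat-bath
# kernels and the factorisation of independent blocks

HONEST FRAMING: elementary finite combinatorics (finite sums only, no measure theory), written for the
centre-projection area law of track Y2 (cell `pub-ymgap`, seat ds-4 g7).  Nothing here is specific to
gauge theories and nothing is claimed about any continuum limit.

Contents (`[Fintype V] [Fintype S]`, weight `ρ : (V → S) → ℝ`):
* `avg ρ f = (∑ σ, ρ σ f σ) / ∑ σ, ρ σ`, `mass ρ`, order properties;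
* the **finite DLR identity** `∑ ρ · hb w x f = ∑ ρ · f` for every `ρ = g · w` with `w > 0` and `g`
  blind to the spin at `x` (`sum_mul_hb`, via the resampling involution `swapAt`), hence
  `avg ρ (hb w x f) = avg ρ f` (`avg_hb`).

References: Friedli–Velenik 2017 §6.2 (DLR equations), §6.5.2 (heat-bath kernels).
-/

noncomputable section

open Finset Function Real

namespace Summit.Ventures.YMGap.RobustBall.FiniteGibbs

variable {V S : Type*} [Fintype V] [DecidableEq V] [Fintype S]

/-! ### Averages -/

/-- The Gibbs average of `f` under the (nonnegative) weight `ρ`: `(∑ ρ f)/(∑ ρ)`. [folklore] -/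
def avg (ρ : (V → S) → ℝ) (f : (V → S) → ℝ) : ℝ := (∑ σ, ρ σ * f σ) / ∑ σ, ρ σ

/-- Total mass of a weight. [folklore] -/
def mass (ρ : (V → S) → ℝ) : ℝ := ∑ σ, ρ σ

/-- The average is at most any upper bound of `f` (for `ρ ≥ 0` of positive mass). [folklore] -/
theorem avg_le_of_le {ρ f : (V → S) → ℝ} (hρ : ∀ σ, 0 ≤ ρ σ) (hm : 0 < mass ρ) {M : ℝ}
    (hf : ∀ σ, f σ ≤ M) : avg ρ f ≤ M := by
  have hm' : 0 < ∑ σ : V → S, ρ σ := hm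
  rw [avg, div_le_iff₀ hm', Finset.mul_sum]
  exact Finset.sum_le_sum fun σ _ => by rw [mul_comm]; exact mul_le_mul_of_nonneg_right (hf σ) (hρ σ)

/-- The average is at least any lower bound of `f`. [folklore] -/
theorem le_avg_of_ge {ρ f : (V → S) → ℝ} (hρ : ∀ σ, 0 ≤ ρ σ) (hm : 0 < mass ρ) {m : ℝ}
    (hf : ∀ σ, m ≤ f σ) : m ≤ avg ρ f := by
  have hm' : 0 < ∑ σ : V → S, ρ σ := hm
  rw [avg, le_div_iff₀ hm', Finset.mul_sum]
  exact Finset.sum_le_sum fun σ _ => by rw [mul_comm]; exact mul_le_mul_of_nonneg_left (hf σ) (hρ σ)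

/-- `|avg ρ f| ≤ M` when `|f| ≤ M`. [folklore] -/
theorem abs_avg_le {ρ f : (V → S) → ℝ} (hρ : ∀ σ, 0 ≤ ρ σ) (hm : 0 < mass ρ) {M : ℝ}
    (hf : ∀ σ, |f σ| ≤ M) : |avg ρ f| ≤ M :=
  abs_le.2 ⟨le_avg_of_ge hρ hm fun σ => (abs_le.1 (hf σ)).1, avg_le_of_le hρ hm fun σ => (abs_le.1 (hf σ)).2⟩

/-- Linearity of the average in the observable: subtraction. [folklore] -/
theorem avg_sub (ρ f g : (V → S) → ℝ) : avg ρ (fun σ => f σ - g σ) = avg ρ f - avg ρ g := by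
  simp only [avg, mul_sub, Finset.sum_sub_distrib, sub_div]

/-- The average of a constant. [folklore] -/
theorem avg_const {ρ : (V → S) → ℝ} (hm : mass ρ ≠ 0) (c : ℝ) : avg ρ (fun _ => c) = c := by
  have hm' : (∑ σ : V → S, ρ σ) ≠ 0 := hm
  rw [avg, ← Finset.sum_mul, mul_comm, mul_div_assoc, div_self hm', mul_one]

/-- A positive weight has positive mass (nonempty configuration space). [folklore] -/
theorem mass_pos_of_pos [Nonempty (V → S)] {ρ : (V → S) → ℝ} (hρ : ∀ σ, 0 < ρ σ) : 0 < mass ρ :=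
  Finset.sum_pos (fun σ _ => hρ σ) Finset.univ_nonempty

/-! ### The finite DLR identity -/

/-- The resampling involution `(σ, s) ↦ (σ^{x←s}, σ x)` of `(V → S) × S`. [folklore] -/
def swapAt (x : V) : (V → S) × S ≃ (V → S) × S where
  toFun p := (update p.1 x p.2, p.1 x)
  invFun p := (update p.1 x p.2, p.1 x)
  left_inv p := by simp
  right_inv p := by simp

/-- **Finite DLR identity**: if `ρ = g · w` with `w > 0` and `g` blind to the spin at `x`, then
`∑ ρ · hb_x f = ∑ ρ · f` (resampling one spin from its conditional law preserves the Gibbs weight;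
Friedli–Velenik 2017, the DLR equation `μ γ_x = μ` in finite volume). [cite: FriedliVelenik2017, §6.2] -/
theorem sum_mul_hb [Nonempty S] {w ρ g : (V → S) → ℝ} (hw : ∀ σ, 0 < w σ) (x : V)
    (hρ : ∀ σ, ρ σ = g σ * w σ) (hg : ∀ σ s, g (update σ x s) = g σ) (f : (V → S) → ℝ) :
    ∑ σ, ρ σ * hb w x f σ = ∑ σ, ρ σ * f σ := by
  -- expand `hb` and write the double sum over `(σ, s)` as a sum over the product type
  have h1 : ∑ σ, ρ σ * hb w x f σ =
      ∑ p : (V → S) × S, ρ p.1 * (hbProb w x p.1 p.2 * f (update p.1 x p.2)) := by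
    simp only [hb, Finset.mul_sum, Fintype.sum_prod_type]
  -- reindex by the involution `swapAt x`
  have h2 : ∑ p : (V → S) × S, ρ p.1 * (hbProb w x p.1 p.2 * f (update p.1 x p.2)) =
      ∑ p : (V → S) × S, g p.1 * w (update p.1 x p.2) * (w p.1 / siteZ w x p.1) * f p.1 := by
    refine Fintype.sum_equiv (swapAt x) _ _ fun p => ?_
    obtain ⟨σ, s⟩ := p
    simp only [swapAt, Equiv.coe_fn_mk, update_idem, update_eq_self]
    have hZ : siteZ w x (update σ x s) = siteZ w x σ := by simp [siteZ]
    rw [hρ σ, hbProb, hZ, hg]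
    ring
  -- sum out the resampled value
  have h3 : ∑ p : (V → S) × S, g p.1 * w (update p.1 x p.2) * (w p.1 / siteZ w x p.1) * f p.1 =
      ∑ σ, ρ σ * f σ := by
    rw [Fintype.sum_prod_type]
    refine Finset.sum_congr rfl fun σ _ => ?_
    have hZ : siteZ w x σ ≠ 0 := (siteZ_pos hw x σ).ne'
    calc ∑ s, g σ * w (update σ x s) * (w σ / siteZ w x σ) * f σ
        = g σ * (w σ / siteZ w x σ) * f σ * ∑ s, w (update σ x s) := by
          rw [Finset.mul_sum]; exact Finset.sum_congr rfl fun s _ => by ring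
      _ = ρ σ * f σ := by
          show g σ * (w σ / siteZ w x σ) * f σ * siteZ w x σ = ρ σ * f σ
          rw [hρ σ]; field_simp
  rw [h1, h2, h3]

/-- DLR identity for averages: `avg ρ (hb w x f) = avg ρ f` under the hypotheses of `sum_mul_hb`. [folklore] -/
theorem avg_hb [Nonempty S] {w ρ g : (V → S) → ℝ} (hw : ∀ σ, 0 < w σ) (x : V)
    (hρ : ∀ σ, ρ σ = g σ * w σ) (hg : ∀ σ s, g (update σ x s) = g σ) (f : (V → S) → ℝ) :
    avg ρ (hb w x f) = avg ρ f := by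
  rw [avg, avg, sum_mul_hb hw x hρ hg]


/-! ### Complex-valued observables -/

/-- The Gibbs average of a complex observable under the real weight `ρ`. [folklore] -/
def cavg (ρ : (V → S) → ℝ) (F : (V → S) → ℂ) : ℂ := (∑ σ, (ρ σ : ℂ) * F σ) / (mass ρ : ℂ)

/-- `‖cavg ρ F‖ ≤ M` when `‖F‖ ≤ M` pointwise (`ρ ≥ 0` of positive mass). [folklore] -/
theorem norm_cavg_le {ρ : (V → S) → ℝ} {F : (V → S) → ℂ} (hρ : ∀ σ, 0 ≤ ρ σ) (hm : 0 < mass ρ) {M : ℝ}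
    (hF : ∀ σ, ‖F σ‖ ≤ M) : ‖cavg ρ F‖ ≤ M := by
  rw [cavg, norm_div, Complex.norm_real, Real.norm_eq_abs, abs_of_pos hm, div_le_iff₀ hm]
  calc ‖∑ σ, (ρ σ : ℂ) * F σ‖ ≤ ∑ σ, ‖(ρ σ : ℂ) * F σ‖ := norm_sum_le _ _
    _ ≤ ∑ σ, ρ σ * M := Finset.sum_le_sum fun σ _ => by
        rw [norm_mul, Complex.norm_real, Real.norm_eq_abs, abs_of_nonneg (hρ σ)]
        exact mul_le_mul_of_nonneg_left (hF σ) (hρ σ)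
    _ = M * mass ρ := by rw [← Finset.sum_mul, mul_comm]; rfl

section Fiber

variable [DecidableEq S]

/-- The weight `ρ` restricted to the fibre `{σ t = s}`. [folklore] -/
def fiber (ρ : (V → S) → ℝ) (t : V) (s : S) : (V → S) → ℝ := fun σ => if σ t = s then ρ σ else 0

omit [Fintype V] [DecidableEq V] [Fintype S] in
/-- The fibre weight is `g · ρ` with `g` the indicator of the fibre. [folklore] -/
theorem fiber_eq (ρ : (V → S) → ℝ) (t : V) (s : S) (σ : V → S) :
    fiber ρ t s σ = (if σ t = s then (1 : ℝ) else 0) * ρ σ := by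
  unfold fiber; split_ifs <;> simp

omit [Fintype V] [Fintype S] in
/-- The indicator of a fibre at `t` is blind to the spins off `t`. [folklore] -/
theorem fiber_indicator_update {t x : V} (hx : x ≠ t) (s : S) (σ : V → S) (u : S) :
    (if update σ x u t = s then (1 : ℝ) else 0) = if σ t = s then 1 else 0 := by
  rw [update_of_ne (Ne.symm hx)]

omit [Fintype V] [DecidableEq V] [Fintype S] in
/-- Fibre weights are nonnegative if `ρ` is. [folklore] -/
theorem fiber_nonneg {ρ : (V → S) → ℝ} (hρ : ∀ σ, 0 ≤ ρ σ) (t : V) (s : S) (σ : V → S) :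
    0 ≤ fiber ρ t s σ := by
  unfold fiber; split_ifs
  · exact hρ σ
  · exact le_rfl

/-- A positive weight has fibres of positive mass. [folklore] -/
theorem mass_fiber_pos [Nonempty S] {ρ : (V → S) → ℝ} (hρ : ∀ σ, 0 < ρ σ) (t : V) (s : S) :
    0 < mass (fiber ρ t s) := by
  classical
  obtain ⟨σ₀⟩ : Nonempty (V → S) := inferInstance
  have hle : fiber ρ t s (update σ₀ t s) ≤ mass (fiber ρ t s) :=
    Finset.single_le_sum (f := fiber ρ t s) (fun σ _ => fiber_nonneg (fun σ => (hρ σ).le) t s σ)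
      (Finset.mem_univ _)
  have hpos : 0 < fiber ρ t s (update σ₀ t s) := by
    have h : fiber ρ t s (update σ₀ t s) = ρ (update σ₀ t s) := by simp [fiber]
    rw [h]; exact hρ _
  exact hpos.trans_le hle

/-- **Law of total expectation over the fibres of one spin**: `∑ ρ F = ∑_s mass(ρ|_{σ_t=s}) · cavg(ρ|_{σ_t=s}) F`
for `ρ ≥ 0`. [folklore] -/
theorem sum_eq_sum_fiber {ρ : (V → S) → ℝ} (hρ : ∀ σ, 0 ≤ ρ σ) (t : V) (F : (V → S) → ℂ) :
    ∑ σ, (ρ σ : ℂ) * F σ = ∑ s, (mass (fiber ρ t s) : ℂ) * cavg (fiber ρ t s) F := by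
  rw [← Finset.sum_fiberwise Finset.univ (fun σ : V → S => σ t) (fun σ => (ρ σ : ℂ) * F σ)]
  refine Finset.sum_congr rfl fun s _ => ?_
  -- the fibre sum is the full sum of the fibre weight
  have hfib : ∑ σ ∈ Finset.univ.filter (fun σ : V → S => σ t = s), (ρ σ : ℂ) * F σ =
      ∑ σ, (fiber ρ t s σ : ℂ) * F σ := by
    rw [Finset.sum_filter]
    refine Finset.sum_congr rfl fun σ _ => ?_
    unfold fiber; split_ifs <;> simp
  rw [hfib, cavg]
  rcases (Finset.sum_nonneg fun σ (_ : σ ∈ Finset.univ) => fiber_nonneg hρ t s σ).eq_or_lt with h0 | hpos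
  · -- massless fibre: both sides vanish
    have hz : ∀ σ, fiber ρ t s σ = 0 := fun σ =>
      (Finset.sum_eq_zero_iff_of_nonneg fun σ _ => fiber_nonneg hρ t s σ).1 h0.symm σ (Finset.mem_univ σ)
    simp [hz, mass]
  · have hm : (mass (fiber ρ t s) : ℂ) ≠ 0 := by
      rw [Ne, Complex.ofReal_eq_zero]; exact (ne_of_gt hpos)
    rw [mul_div_cancel₀ _ hm]

/-- **Conditioning on one spin**: for `ρ ≥ 0` of positive mass, an observable `F` and a function `G` of the
spin at `t`, `cavg ρ (F · G(σ_t)) − cavg ρ F · cavg ρ G(σ_t) = ∑_s (mass_s/mass) G(s) (cavg_s F − cavg F)`, hence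
its norm is at most `sup ‖G‖ · sup_s ‖cavg(ρ|_{σ_t=s}) F − cavg ρ F‖`. [folklore] -/
theorem norm_cavg_mul_sub_le {ρ : (V → S) → ℝ} (hρ : ∀ σ, 0 ≤ ρ σ) (hm : 0 < mass ρ)
    (t : V) (F : (V → S) → ℂ) (G : S → ℂ) {MG B : ℝ} (hG : ∀ s, ‖G s‖ ≤ MG)
    (hB : ∀ s, 0 < mass (fiber ρ t s) → ‖cavg (fiber ρ t s) F - cavg ρ F‖ ≤ B) :
    ‖cavg ρ (fun σ => F σ * G (σ t)) - cavg ρ F * cavg ρ (fun σ => G (σ t))‖ ≤ MG * B := by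
  have hmC : (mass ρ : ℂ) ≠ 0 := by rw [Ne, Complex.ofReal_eq_zero]; exact hm.ne'
  -- fibre decompositions of the two averages
  have h1 : cavg ρ (fun σ => F σ * G (σ t)) =
      ∑ s, ((mass (fiber ρ t s) : ℂ) / mass ρ) * (G s * cavg (fiber ρ t s) F) := by
    rw [cavg, sum_eq_sum_fiber hρ t, Finset.sum_div]
    refine Finset.sum_congr rfl fun s _ => ?_
    have hGs : cavg (fiber ρ t s) (fun σ => F σ * G (σ t)) = G s * cavg (fiber ρ t s) F := by
      rw [cavg, cavg, ← mul_div_assoc, Finset.mul_sum]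
      congr 1
      refine Finset.sum_congr rfl fun σ _ => ?_
      unfold fiber
      split_ifs with h
      · rw [h]; ring
      · simp
    rw [hGs]; ring
  have h2 : cavg ρ (fun σ => G (σ t)) = ∑ s, ((mass (fiber ρ t s) : ℂ) / mass ρ) * G s := by
    rw [cavg, sum_eq_sum_fiber hρ t, Finset.sum_div]
    refine Finset.sum_congr rfl fun s _ => ?_
    rcases (Finset.sum_nonneg fun σ (_ : σ ∈ Finset.univ) => fiber_nonneg hρ t s σ).eq_or_lt with h0 | hpos
    · have : mass (fiber ρ t s) = 0 := h0.symm
      simp [this]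
    · have hms : (mass (fiber ρ t s) : ℂ) ≠ 0 := by rw [Ne, Complex.ofReal_eq_zero]; exact hpos.ne'
      have hGs : cavg (fiber ρ t s) (fun σ => G (σ t)) = G s := by
        rw [cavg]
        have : ∑ σ, (fiber ρ t s σ : ℂ) * G (σ t) = ∑ σ, (fiber ρ t s σ : ℂ) * G s := by
          refine Finset.sum_congr rfl fun σ _ => ?_
          unfold fiber; split_ifs with h
          · rw [h]
          · simp
        rw [this, ← Finset.sum_mul, mul_comm, mul_div_assoc]
        rw [show (∑ σ, (fiber ρ t s σ : ℂ)) = (mass (fiber ρ t s) : ℂ) by rw [mass]; push_cast; rfl,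
          div_self hms, mul_one]
      rw [hGs]; ring
  -- the weights `mass_s / mass` form a probability vector
  have hsum1 : ∑ s, mass (fiber ρ t s) = mass ρ := by
    have h := sum_eq_sum_fiber hρ t (fun _ => (1 : ℂ))
    simp only [mul_one, cavg] at h
    have h' : ∀ s, (mass (fiber ρ t s) : ℂ) * ((∑ σ, (fiber ρ t s σ : ℂ)) / (mass (fiber ρ t s) : ℂ)) =
        (mass (fiber ρ t s) : ℂ) := by
      intro s
      rcases eq_or_ne (mass (fiber ρ t s) : ℂ) 0 with h0 | h0
      · rw [h0, zero_mul]
      · rw [mul_div_cancel₀]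
        · rw [mass]; push_cast; rfl
        · exact h0
    simp only [h'] at h
    have : ((∑ σ, ρ σ : ℝ) : ℂ) = ((∑ s, mass (fiber ρ t s) : ℝ) : ℂ) := by push_cast; exact h
    exact_mod_cast this.symm
  -- the difference
  have hdiff : cavg ρ (fun σ => F σ * G (σ t)) - cavg ρ F * cavg ρ (fun σ => G (σ t)) =
      ∑ s, ((mass (fiber ρ t s) : ℂ) / mass ρ) * G s * (cavg (fiber ρ t s) F - cavg ρ F) := by
    rw [h1, h2, Finset.mul_sum, ← Finset.sum_sub_distrib]
    exact Finset.sum_congr rfl fun s _ => by ring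
  rw [hdiff]
  calc ‖∑ s, ((mass (fiber ρ t s) : ℂ) / mass ρ) * G s * (cavg (fiber ρ t s) F - cavg ρ F)‖
      ≤ ∑ s, ‖((mass (fiber ρ t s) : ℂ) / mass ρ) * G s * (cavg (fiber ρ t s) F - cavg ρ F)‖ :=
        norm_sum_le _ _
    _ ≤ ∑ s, (mass (fiber ρ t s) / mass ρ) * (MG * B) := by
        refine Finset.sum_le_sum fun s _ => ?_
        have hms0 : 0 ≤ mass (fiber ρ t s) := Finset.sum_nonneg fun σ _ => fiber_nonneg hρ t s σ
        rcases hms0.eq_or_lt with h0 | hpos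
        · rw [← h0]; simp
        · rw [norm_mul, norm_mul, norm_div, Complex.norm_real, Complex.norm_real, Real.norm_eq_abs,
            Real.norm_eq_abs, abs_of_pos hpos, abs_of_pos hm, mul_assoc]
          refine mul_le_mul_of_nonneg_left ?_ (div_nonneg hpos.le hm.le)
          exact mul_le_mul (hG s) (hB s hpos) (norm_nonneg _) ((norm_nonneg _).trans (hG s))
    _ = MG * B := by
        rw [← Finset.sum_mul, ← Finset.sum_div, hsum1, div_self hm.ne', one_mul]

end Fiber

/-- The real part of a complex average is a real average. [folklore] -/
theorem re_cavg (ρ : (V → S) → ℝ) (F : (V → S) → ℂ) : (cavg ρ F).re = avg ρ (fun σ => (F σ).re) := by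
  rw [cavg, Complex.div_ofReal_re, Complex.re_sum, avg, mass]
  simp only [Complex.re_ofReal_mul]

/-- The imaginary part of a complex average is a real average. [folklore] -/
theorem im_cavg (ρ : (V → S) → ℝ) (F : (V → S) → ℂ) : (cavg ρ F).im = avg ρ (fun σ => (F σ).im) := by
  rw [cavg, Complex.div_ofReal_im, Complex.im_sum, avg, mass]
  simp only [Complex.im_ofReal_mul]

/-- `‖cavg ρ₁ F − cavg ρ₂ F‖` is at most the sum of the differences of the real and imaginary averages. [folklore] -/
theorem norm_cavg_sub_cavg_le (ρ₁ ρ₂ : (V → S) → ℝ) (F : (V → S) → ℂ) :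
    ‖cavg ρ₁ F - cavg ρ₂ F‖ ≤ |avg ρ₁ (fun σ => (F σ).re) - avg ρ₂ (fun σ => (F σ).re)| +
      |avg ρ₁ (fun σ => (F σ).im) - avg ρ₂ (fun σ => (F σ).im)| := by
  rw [← re_cavg, ← re_cavg, ← im_cavg, ← im_cavg, ← Complex.sub_re, ← Complex.sub_im]
  exact Complex.norm_le_abs_re_add_abs_im _

/-! ### Independence of blocks -/

omit [Fintype V] [Fintype S] in
/-- Merge two configurations along a set of sites: `σ` on `B`, `τ` off `B`. [folklore] -/
theorem piecewise_mem_compl (B : Finset V) (σ τ : V → S) :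
    (∀ i ∈ (↑B : Set V), B.piecewise σ τ i = σ i) ∧ ∀ i ∈ (↑B : Set V)ᶜ, B.piecewise σ τ i = τ i :=
  ⟨fun _ hi => Finset.piecewise_eq_of_mem _ _ _ (Finset.mem_coe.1 hi),
    fun _ hi => Finset.piecewise_eq_of_notMem _ _ _ fun h => hi (Finset.mem_coe.2 h)⟩

omit [Fintype V] [Fintype S] in
/-- Exchanging the `B`-parts twice is the identity. [folklore] -/
theorem piecewise_swap_swap (B : Finset V) (σ τ : V → S) :
    B.piecewise (B.piecewise σ τ) (B.piecewise τ σ) = σ := by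
  funext i
  by_cases hi : i ∈ B
  · simp [hi]
  · simp [hi]

/-- The block-exchange involution `(σ, τ) ↦ (σ|_B ∪ τ|_{Bᶜ}, τ|_B ∪ σ|_{Bᶜ})`. [folklore] -/
def blockSwap (B : Finset V) : (V → S) × (V → S) ≃ (V → S) × (V → S) where
  toFun p := (B.piecewise p.1 p.2, B.piecewise p.2 p.1)
  invFun p := (B.piecewise p.1 p.2, B.piecewise p.2 p.1)
  left_inv p := Prod.ext (piecewise_swap_swap B p.1 p.2) (piecewise_swap_swap B p.2 p.1)
  right_inv p := Prod.ext (piecewise_swap_swap B p.1 p.2) (piecewise_swap_swap B p.2 p.1)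

/-- **Independence of blocks**: if the weight factorises as `u · v` with `u` reading only the spins in `B`
and `v` only those off `B`, and `F` reads only `B`, `G` only `Bᶜ`, then
`(∑ uv F G)(∑ uv) = (∑ uv F)(∑ uv G)` (product measure ⇒ product of expectations). [folklore] -/
theorem sum_mul_sum_eq_of_dependsOn (B : Finset V) {u v : (V → S) → ℝ} {F G : (V → S) → ℂ}
    (hu : DependsOn u (↑B : Set V)) (hv : DependsOn v (↑B : Set V)ᶜ)
    (hF : DependsOn F (↑B : Set V)) (hG : DependsOn G (↑B : Set V)ᶜ) :
    (∑ σ, (u σ * v σ : ℝ) * (F σ * G σ)) * (∑ σ, ((u σ * v σ : ℝ) : ℂ)) =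
      (∑ σ, (u σ * v σ : ℝ) * F σ) * (∑ σ, (u σ * v σ : ℝ) * G σ) := by
  rw [Finset.sum_mul_sum, Finset.sum_mul_sum, ← Fintype.sum_prod_type', ← Fintype.sum_prod_type']
  refine Fintype.sum_equiv (blockSwap B) _ _ fun p => ?_
  obtain ⟨σ, τ⟩ := p
  simp only [blockSwap, Equiv.coe_fn_mk]
  have hσ := piecewise_mem_compl B σ τ
  have hτ := piecewise_mem_compl B τ σ
  rw [hu hσ.1, hv hσ.2, hF hσ.1, hu hτ.1, hv hτ.2, hG hτ.2]
  push_cast; ring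

/-- **Independence of blocks, average form**: `cavg (u·v) (F·G) = cavg (u·v) F · cavg (u·v) G`. [folklore] -/
theorem cavg_mul_eq_of_dependsOn (B : Finset V) {u v : (V → S) → ℝ} {F G : (V → S) → ℂ}
    (hu : DependsOn u (↑B : Set V)) (hv : DependsOn v (↑B : Set V)ᶜ)
    (hF : DependsOn F (↑B : Set V)) (hG : DependsOn G (↑B : Set V)ᶜ)
    (hm : mass (fun σ => u σ * v σ) ≠ 0) :
    cavg (fun σ => u σ * v σ) (fun σ => F σ * G σ) =
      cavg (fun σ => u σ * v σ) F * cavg (fun σ => u σ * v σ) G := by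
  have hmC : ((mass fun σ => u σ * v σ : ℝ) : ℂ) ≠ 0 := by rw [Ne, Complex.ofReal_eq_zero]; exact hm
  have hmass : ((mass fun σ => u σ * v σ : ℝ) : ℂ) = ∑ σ, ((u σ * v σ : ℝ) : ℂ) := by
    rw [mass]; push_cast; rfl
  simp only [cavg]
  rw [div_mul_div_comm, div_eq_div_iff hmC (mul_ne_zero hmC hmC), hmass, ← mul_assoc,
    sum_mul_sum_eq_of_dependsOn B hu hv hF hG]

end Summit.Ventures.YMGap.RobustBall.FiniteGibbs

end
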